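import Literature.MathematicalPhysics.QuantumFieldTheory.Balaban1983to89.B6Hprime2132Holder

/-!
# `Balaban1983to89.B6Hprime2132HolderKernel` — T. Bałaban, *Propagators and renormalization transformations for lattice
# gauge theories. II*, Commun. Math. Phys. **96** (1984) 223–250 [Balaban1984PropagatorsII], Sect. C p. 246 (the sentence
# after (2.132)): the LOCAL HÖLDER QUOTIENTS of the derivative kernels of `H′_j` — uniformly bounded, with a uniform
# exponential decay whose rate depends on `d` only (kernel level, every `n ≥ 1`)

statement-level skeleton of published theorems with citation tags; proofs where landed; nothing here is a claim about the Yang–Mills mass gap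

PDF held: `paper:balaban1984-cmp96-propagators-rt-ii` (journal page = PDF page + 222); p. 246 [PDF 24] and p. 234 [PDF 12]
read AS IMAGES on the ×2 renders `run/shared/lean/pub/pub-balaban/b2b-balaban-ref1/pages/1984-cmp96-propagators-rt-II/
…-p024-x2.png`, `…-p012-x2.png`.

CITATION HEADER (lean-in-tree rule).  WHAT IS REPRODUCED: lit-balaban SKELETON row **B6.Eq2.132** — the momentum
representation (2.132) p. 246 *"(H′_jμ)~(p′+l) = ū_j(p′+l)/Δ²(p′+l) · (Σ_{l′}|u_j(p′+l′)|²/Δ²(p′+l′))⁻¹ μ̃(p′)"* (typed in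
`…B6Hprime2101` as `hPrinted`, regrouped `hP`) and the sentence after it, verbatim: *"This representation together with the
analyticity method described in [3] imply that derivatives of H′_j up to third order, and their local Hölder norms as in
(2.67), are uniformly bounded and have a uniform exponential decay with a decay rate depending on d only."*; p. 234 (2.67)
(Proposition 2.2) prints the local Hölder entries as `‖ζ∇G′λ‖_α`, `‖ζG′∇*λ‖_α` with a cut-off `ζ`, `supp ζ ⊂ B^j(y)` — a
Hölder quotient taken INSIDE ONE BLOCK.  State of the row before this file: `…B6Hprime2101` (multipliers on the `d`-only
strip, kernel decay of `H′_j`), `…B6Hprime2132Holder` (r03 gen 4: the `n`-uniform weighted alias sums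
`weighted_alias_sum_hP_le` — which ALREADY carry the Hölder weight `(Σ_ν‖∂_ν(p′+l)‖²)^{α/2}` — and the derivative kernels
`latticeKernel_GHD_decay`, orders `m ≤ 3`).  THIS FILE supplies the last kernel-level piece of the printed sentence: the
HÖLDER QUOTIENT of the `m`-th derivative kernel between two fine points `y + ηa`, `y + ηã` of the SAME unit cube (the
block of the unit lattice on which `μ` lives), uniformly bounded by `C(d,m,α)·|ηa − ηã|_∞^α` times `e^{−κ_N(d+1)|x|_∞}`.
Unit `lit-balaban-r03` (B6 reader/typer and fold owner, gen 6), PHASE 2 (G.1), HOME `run/shared/lean/pub/lit-balaban/`,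
2026-08-21.  IMPORTS `…B6Hprime2132Holder` (hence `…B6Hprime2101`, `…B5Hk163*`, the b04 engine `…B4ContourShift` /
`…B4TorusKernel`) — everything BY NAME; nothing of the tree is restated; no `def`, no new named fact.

THE ARGUMENT (ours; the paper prints none).  With `w_ν = e^{iη(p′+l)_ν}` the fine-offset phase is
`e^{i(p′+l)·ηa} = Π_ν w_ν^{a_ν}` (`B5Hk163Decay.phase163`) and `∂_ν(p′+l) = η⁻¹(w_ν − 1)` (`B5Hk163Strip.dC`).  (i) One
coordinate: `w^a − w^ã = w^{min}(w − 1)Σ_{t<|a−ã|}w^t`, and every power `w^j`, `j < n`, has modulus `≤ e^κ` on the strip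
(`B5Hk163Decay.norm_exp_shift_pow_le`), so `‖w^a − w^ã‖ ≤ e^κ·η‖∂_ν(p′+l)‖·|a − ã|` (`norm_pow_sub_pow_le`).  (ii)
Telescoping the product over the `d` coordinates (`norm_prod_sub_prod_le_pow`):
`‖e^{i(p′+l)·ηa} − e^{i(p′+l)·ηã}‖ ≤ e^{κ(d+1)}·η·Σ_ν‖∂_ν(p′+l)‖·|a_ν − ã_ν|` (`norm_phase163_sub_le_sum`), and trivially
`≤ 2e^{κd}`.  (iii) Interpolation `X ≤ C ∧ X ≤ Ct ⇒ X ≤ Ct^α` (`le_mul_rpow_of_le_of_le_mul`) and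
`(Σ_ν u_ν)^α ≤ (d+1)(Σ_ν u_ν²)^{α/2}` give the HÖLDER FORM
`‖e^{i(p′+l)·ηa} − e^{i(p′+l)·ηã}‖ ≤ 2e^{κ(d+1)}(d+1)·(η|a − ã|_∞)^α·(Σ_ν‖∂_ν(p′+l)‖²)^{α/2}` (`norm_phase163_sub_le_holder`)
— exactly the weight of `B6Hprime2132Holder.wtD`.  (iv) Hence the Hölder-difference multiplier
`G′_{a;ν}(p′) − G′_{ã;ν}(p′) = Σ_l (e^{i(p′+l)·ηa} − e^{i(p′+l)·ηã})Π_i∂_{ν_i}(p′+l)h′_l(p′)` is bounded on the whole zero-free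
strip by `2e^{κ(d+1)}(d+1)·C′(d,m,α)·(η|a − ã|_∞)^α` (`norm_GHD_sub_le`, via `weighted_alias_sum_hP_le`), is strip regular
(`stripRegular_GHD_sub`), and the b04 engine (`B4ContourShift.latticeKernel_decay`) turns this into the kernel statement.

WHAT IS PROVED (0 sorry, 0 defs, 0 new named facts; constants OURS, crude, depending on `d`, `m`, `α` only; every `n ≥ 1`).
§1 pure inequalities; §2 the phase-difference bounds (i)–(iii); §3 `norm_GHD_sub_le`; §4 `stripRegular_GHD_sub`; §5
`latticeKernel_sub`, **`latticeKernel_GHD_holder`**: for `m ≤ 3` directions, `0 ≤ α < 1`, fine offsets `a, ã` with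
`|a_ν − ã_ν| ≤ δ` and every `x ∈ ℤ^{d+1}`,
`‖K′_{a;ν}(x) − K′_{ã;ν}(x)‖ ≤ 2e^{d+2}(d+2)·C′(d+1,m,α)·(δ/n)^α·e^{−κ_N(d+1)|x|_∞}` — i.e. (taking `δ = |a − ã|_∞`) the local
Hölder quotient `|∂^ξ_{ν₁}⋯∂^ξ_{ν_m}H′_j(y+ηa, y′) − ∂^ξ_{ν₁}⋯∂^ξ_{ν_m}H′_j(y+ηã, y′)| / |ηa − ηã|_∞^α` of the derivative kernel is
bounded uniformly in `n`, `y`, `y′`, `a ≠ ã` with the exponential decay `e^{−κ_N(d+1)|y−y′|_∞}`, rate depending on `d` only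
(*"their local Hölder norms as in (2.67), are uniformly bounded and have a uniform exponential decay with a decay rate
depending on d only"*); `torusKernel_descend_sub`, `torusKernel_GHD_holder`: the same on every torus `Π_μ ℤ/N_μ`
(rate `κ_N(d+1)/(d+1)` in the torus distance, constant `× periodConst`).
HONEST SCOPE.  (i) As in `…B5Hk163Holder` / `…B6Hprime2132Holder`: the kernels are the `ℤ^{d+1}`-Fourier kernels
`B4ContourShift.latticeKernel` of the printed multipliers (the dictionary «kernel of the operator with momentum representation
(2.132) from the unit point `y′` to the fine point `y + ηa`» = `latticeKernel (GHD n a νs) (y − y′)` of `…B6Hprime2101` §3 /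
`…B5Hk163Decay` §4); no operator on `ℓ²` is typed here.  (ii) The two fine points lie in the same unit cube (`a, ã ∈
{0,…,n−1}^{d+1}`): the LOCAL Hölder quotient of (2.67); quotients across neighbouring cubes follow by the triangle inequality
through a common corner and are not spelled out.  (iii) The constant diverges as `α → 1`; orders `m ≥ 4` are not claimed (and
not printed).  (iv) Value = kernel certificate of a located, asserted step of [Balaban1984PropagatorsII]; NOT summit progress.
-/

open scoped BigOperators Real
open Finset Complex

namespace Literature.MathematicalPhysics.QuantumFieldTheory.Balaban1983to89.B6Hprime2132HolderKernel

open Literature.MathematicalPhysics.QuantumFieldTheory.Balaban1983to89.B4Strip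
open Literature.MathematicalPhysics.QuantumFieldTheory.Balaban1983to89.B4StripCauchy
open Literature.MathematicalPhysics.QuantumFieldTheory.Balaban1983to89.B4ContourShift
open Literature.MathematicalPhysics.QuantumFieldTheory.Balaban1983to89.B4TorusKernel (descend descendC descendC_apply
  periodConst)
open Literature.MathematicalPhysics.QuantumFieldTheory.Balaban1983to89.B4TorusKernel.MultiPeriod (torusKernel torusSum
  torusSupNorm torusKernel_descend_decay_torusMetric)
open Literature.MathematicalPhysics.QuantumFieldTheory.Balaban1983to89.B5Strip145Analytic
open Literature.MathematicalPhysics.QuantumFieldTheory.Balaban1983to89.B5Strip145Decay (differentiableAt_insertNth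
  tr_insertNth_left insertNth_left_mem)
open Literature.MathematicalPhysics.QuantumFieldTheory.Balaban1983to89.B5Hk163Strip
open Literature.MathematicalPhysics.QuantumFieldTheory.Balaban1983to89.B5Hk163Decay (phase163 norm_phase163_le
  norm_exp_shift_pow_le)
open Literature.MathematicalPhysics.QuantumFieldTheory.Balaban1983to89.B6Hprime2101 (hP)
open Literature.MathematicalPhysics.QuantumFieldTheory.Balaban1983to89.B6Hprime2132Holder (wtD CHolder2132
  CHolder2132_nonneg weighted_alias_sum_hP_le GHD GHD_tr differentiableAt_GHD stripRegular_GHD)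

variable {d : ℕ}

/-! ## §1. Two telescoping inequalities, an interpolation and a Cauchy–Schwarz step (pure inequalities) -/

section Pure

/-- `‖w^a − w^b‖ ≤ B·‖w − 1‖·|a − b|` when every power `w^j`, `j < N`, has norm `≤ B` and `a, b < N`
(`w^a − w^b = w^{min}(w − 1)Σ_{t<|a−b|}w^t`). [folklore] -/
private theorem norm_pow_sub_pow_le {w : ℂ} {B : ℝ} {N a b : ℕ} (hB : ∀ j : ℕ, j < N → ‖w ^ j‖ ≤ B)
    (ha : a < N) (hb : b < N) : ‖w ^ a - w ^ b‖ ≤ B * ‖w - 1‖ * |(a : ℝ) - b| := by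
  wlog hba : b ≤ a generalizing a b
  · have h := this hb ha (le_of_not_ge hba)
    rw [norm_sub_rev, abs_sub_comm]
    exact h
  obtain ⟨t, rfl⟩ := Nat.exists_eq_add_of_le hba
  have hrepr : w ^ (b + t) - w ^ b = (∑ i ∈ Finset.range t, w ^ (b + i)) * (w - 1) := by
    calc w ^ (b + t) - w ^ b = w ^ b * (w ^ t - 1) := by rw [pow_add, mul_sub_one]
      _ = w ^ b * ((∑ i ∈ Finset.range t, w ^ i) * (w - 1)) := by rw [geom_sum_mul]
      _ = (∑ i ∈ Finset.range t, w ^ b * w ^ i) * (w - 1) := by rw [← mul_assoc, Finset.mul_sum]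
      _ = (∑ i ∈ Finset.range t, w ^ (b + i)) * (w - 1) := by simp_rw [pow_add]
  have hsum : ‖∑ i ∈ Finset.range t, w ^ (b + i)‖ ≤ t * B := by
    calc ‖∑ i ∈ Finset.range t, w ^ (b + i)‖ ≤ ∑ i ∈ Finset.range t, ‖w ^ (b + i)‖ := norm_sum_le _ _
      _ ≤ ∑ _i ∈ Finset.range t, B :=
          Finset.sum_le_sum fun i hi => hB (b + i) (by have := Finset.mem_range.mp hi; omega)
      _ = t * B := by rw [Finset.sum_const, Finset.card_range, nsmul_eq_mul]
  have habs : |((b + t : ℕ) : ℝ) - b| = t := by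
    push_cast
    rw [add_sub_cancel_left]
    exact abs_of_nonneg (Nat.cast_nonneg t)
  rw [hrepr, norm_mul, habs]
  calc ‖∑ i ∈ Finset.range t, w ^ (b + i)‖ * ‖w - 1‖ ≤ (t * B) * ‖w - 1‖ :=
        mul_le_mul_of_nonneg_right hsum (norm_nonneg _)
    _ = B * ‖w - 1‖ * t := by ring

/-- telescoping a product: if `‖f_i‖, ‖g_i‖ ≤ B` on `s` with `B ≥ 1`, then
`‖Π_s f − Π_s g‖ ≤ B^{#s}·Σ_s ‖f_i − g_i‖`. [folklore] -/
private theorem norm_prod_sub_prod_le_pow {ι : Type*} (s : Finset ι) {f g : ι → ℂ} {B : ℝ} (hB : 1 ≤ B)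
    (hf : ∀ i ∈ s, ‖f i‖ ≤ B) (hg : ∀ i ∈ s, ‖g i‖ ≤ B) :
    ‖∏ i ∈ s, f i - ∏ i ∈ s, g i‖ ≤ B ^ s.card * ∑ i ∈ s, ‖f i - g i‖ := by
  classical
  induction s using Finset.induction_on with
  | empty => simp
  | insert j s hj ih =>
    have hf' : ∀ i ∈ s, ‖f i‖ ≤ B := fun i hi => hf i (Finset.mem_insert_of_mem hi)
    have hg' : ∀ i ∈ s, ‖g i‖ ≤ B := fun i hi => hg i (Finset.mem_insert_of_mem hi)
    have ih' := ih hf' hg'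
    have hB0 : 0 ≤ B := zero_le_one.trans hB
    have hPg : ‖∏ i ∈ s, g i‖ ≤ B ^ s.card := by
      rw [norm_prod]
      calc ∏ i ∈ s, ‖g i‖ ≤ ∏ _i ∈ s, B := Finset.prod_le_prod (fun i _ => norm_nonneg _) hg'
        _ = B ^ s.card := Finset.prod_const B
    have hsum0 : 0 ≤ ∑ i ∈ s, ‖f i - g i‖ := Finset.sum_nonneg fun i _ => norm_nonneg _
    have hfj : ‖f j‖ ≤ B := hf j (Finset.mem_insert_self j s)
    rw [Finset.prod_insert hj, Finset.prod_insert hj, Finset.card_insert_of_notMem hj, Finset.sum_insert hj]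
    have hsplit : f j * ∏ i ∈ s, f i - g j * ∏ i ∈ s, g i =
        f j * (∏ i ∈ s, f i - ∏ i ∈ s, g i) + (f j - g j) * ∏ i ∈ s, g i := by ring
    have hpow : B ^ s.card ≤ B ^ (s.card + 1) := by
      rw [pow_succ]
      exact le_mul_of_one_le_right (pow_nonneg hB0 _) hB
    calc ‖f j * ∏ i ∈ s, f i - g j * ∏ i ∈ s, g i‖
        = ‖f j * (∏ i ∈ s, f i - ∏ i ∈ s, g i) + (f j - g j) * ∏ i ∈ s, g i‖ := by rw [hsplit]
      _ ≤ ‖f j‖ * ‖∏ i ∈ s, f i - ∏ i ∈ s, g i‖ + ‖f j - g j‖ * ‖∏ i ∈ s, g i‖ := by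
          refine (norm_add_le _ _).trans ?_
          rw [norm_mul, norm_mul]
      _ ≤ B * (B ^ s.card * ∑ i ∈ s, ‖f i - g i‖) + ‖f j - g j‖ * B ^ s.card :=
          add_le_add (mul_le_mul hfj ih' (norm_nonneg _) hB0)
            (mul_le_mul_of_nonneg_left hPg (norm_nonneg _))
      _ = B ^ (s.card + 1) * ∑ i ∈ s, ‖f i - g i‖ + B ^ s.card * ‖f j - g j‖ := by rw [pow_succ]; ring
      _ ≤ B ^ (s.card + 1) * ∑ i ∈ s, ‖f i - g i‖ + B ^ (s.card + 1) * ‖f j - g j‖ :=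
          add_le_add le_rfl (mul_le_mul_of_nonneg_right hpow (norm_nonneg _))
      _ = B ^ (s.card + 1) * (‖f j - g j‖ + ∑ i ∈ s, ‖f i - g i‖) := by ring

/-- interpolation between a trivial and a Lipschitz bound: `X ≤ C` and `X ≤ C·t` (`t ≥ 0`) give `X ≤ C·t^α` for every
`0 ≤ α ≤ 1`. [folklore] -/
private theorem le_mul_rpow_of_le_of_le_mul {X C t α : ℝ} (hC : 0 ≤ C) (ht : 0 ≤ t) (hα0 : 0 ≤ α) (hα1 : α ≤ 1)
    (h1 : X ≤ C) (h2 : X ≤ C * t) : X ≤ C * t ^ α := by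
  rcases le_or_gt t 1 with ht1 | ht1
  · have hle : t ≤ t ^ α := by
      rcases ht.eq_or_lt with h0 | ht0
      · rw [← h0]
        exact Real.rpow_nonneg le_rfl α
      · calc t = t ^ (1 : ℝ) := (Real.rpow_one t).symm
          _ ≤ t ^ α := Real.rpow_le_rpow_of_exponent_ge ht0 ht1 hα1
    exact h2.trans (mul_le_mul_of_nonneg_left hle hC)
  · have hle : 1 ≤ t ^ α := Real.one_le_rpow ht1.le hα0
    calc X ≤ C := h1
      _ = C * 1 := (mul_one C).symm
      _ ≤ C * t ^ α := mul_le_mul_of_nonneg_left hle hC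

/-- the Cauchy–Schwarz step behind the Hölder weight: for `u_ν ≥ 0` and `0 ≤ α ≤ 1`,
`(Σ_ν u_ν)^α ≤ (d+1)·(Σ_ν u_ν²)^{α/2}`. [folklore] -/
private theorem rpow_sum_le_mul_rpow_sum_sq (u : Fin d → ℝ) (hu : ∀ ν, 0 ≤ u ν) {α : ℝ} (hα0 : 0 ≤ α) (hα1 : α ≤ 1) :
    (∑ ν, u ν) ^ α ≤ ((d : ℝ) + 1) * (∑ ν, u ν ^ 2) ^ (α / 2) := by
  have hS0 : 0 ≤ ∑ ν, u ν := Finset.sum_nonneg fun ν _ => hu ν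
  have hQ0 : 0 ≤ ∑ ν, u ν ^ 2 := Finset.sum_nonneg fun ν _ => sq_nonneg _
  have hd1 : (1 : ℝ) ≤ (d : ℝ) + 1 := by
    have : (0 : ℝ) ≤ d := Nat.cast_nonneg d
    linarith
  have hcs : (∑ ν, u ν) ^ 2 ≤ ((d : ℝ) + 1) * ∑ ν, u ν ^ 2 := by
    have h := Finset.sum_mul_sq_le_sq_mul_sq (Finset.univ : Finset (Fin d)) (fun _ => (1 : ℝ)) u
    simp only [one_mul, one_pow, Finset.sum_const, Finset.card_univ, Fintype.card_fin, nsmul_eq_mul, mul_one] at h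
    calc (∑ ν, u ν) ^ 2 ≤ (d : ℝ) * ∑ ν, u ν ^ 2 := h
      _ ≤ ((d : ℝ) + 1) * ∑ ν, u ν ^ 2 := by nlinarith
  have hα2 : 0 ≤ α / 2 := by linarith
  calc (∑ ν, u ν) ^ α = ((∑ ν, u ν) ^ 2) ^ (α / 2) := by
        rw [← Real.rpow_natCast (∑ ν, u ν) 2, ← Real.rpow_mul hS0]
        congr 1
        push_cast
        ring
    _ ≤ (((d : ℝ) + 1) * ∑ ν, u ν ^ 2) ^ (α / 2) := Real.rpow_le_rpow (sq_nonneg _) hcs hα2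
    _ = ((d : ℝ) + 1) ^ (α / 2) * (∑ ν, u ν ^ 2) ^ (α / 2) := Real.mul_rpow (by linarith) hQ0
    _ ≤ ((d : ℝ) + 1) * (∑ ν, u ν ^ 2) ^ (α / 2) := by
        refine mul_le_mul_of_nonneg_right ?_ (Real.rpow_nonneg hQ0 _)
        calc ((d : ℝ) + 1) ^ (α / 2) ≤ ((d : ℝ) + 1) ^ (1 : ℝ) :=
              Real.rpow_le_rpow_of_exponent_le hd1 (by linarith)
          _ = (d : ℝ) + 1 := Real.rpow_one _

end Pure

/-! ## §2. The fine-offset phase difference `e^{i(p′+l)·ηa} − e^{i(p′+l)·ηã}` on the strip -/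

section Phase

variable (n : ℕ) [NeZero n]

/-- **THE LIPSCHITZ FORM**: on `Strip d κ` (`κ ≥ 0`), for every alias `l = 2πk` and fine offsets `a, ã ∈ {0,…,n−1}^d`,
`‖e^{i(p′+l)·ηa} − e^{i(p′+l)·ηã}‖ ≤ e^{κ(d+1)}·η·Σ_ν ‖∂_ν(p′+l)‖·|a_ν − ã_ν|` (`η = 1/n`; coordinatewise
`w^a − w^ã = w^{min}(w−1)Σw^t`, then the product telescoped). [cite: Balaban1984PropagatorsII, p.246 (text only; inequality ours)] -/
theorem norm_phase163_sub_le_sum {κ : ℝ} (hκ0 : 0 ≤ κ) {p : Fin d → ℂ} (hp : p ∈ Strip d κ)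
    (k a a' : Fin d → Fin n) :
    ‖phase163 n k a p - phase163 n k a' p‖ ≤
      Real.exp κ ^ (d + 1) / n * ∑ ν, ‖dC n k p ν‖ * |((a ν : ℕ) : ℝ) - ((a' ν : ℕ) : ℝ)| := by
  have hn : (0 : ℝ) < n := Nat.cast_pos.mpr (Nat.pos_of_ne_zero (NeZero.ne n))
  have hB : 1 ≤ Real.exp κ := Real.one_le_exp hκ0
  set w : Fin d → ℂ := fun ν => Complex.exp (shift n k p ν / n * I) with hw
  have hpow : ∀ (ν : Fin d) (j : ℕ), j < n → ‖w ν ^ j‖ ≤ Real.exp κ :=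
    fun ν j hj => norm_exp_shift_pow_le n hp k ν ⟨j, hj⟩
  have hph : ∀ b : Fin d → Fin n, phase163 n k b p = ∏ ν, w ν ^ (b ν : ℕ) := fun b => rfl
  have hdC : ∀ ν, ‖w ν - 1‖ = ‖dC n k p ν‖ / n := by
    intro ν
    have h : dC n k p ν = (n : ℂ) * (w ν - 1) := rfl
    rw [h, norm_mul, Complex.norm_natCast, mul_div_cancel_left₀ _ hn.ne']
  have h1 : ‖phase163 n k a p - phase163 n k a' p‖ ≤
      Real.exp κ ^ d * ∑ ν, ‖w ν ^ (a ν : ℕ) - w ν ^ (a' ν : ℕ)‖ := by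
    rw [hph a, hph a']
    have h := norm_prod_sub_prod_le_pow (Finset.univ : Finset (Fin d)) hB
      (fun ν _ => hpow ν _ (a ν).isLt) (fun ν _ => hpow ν _ (a' ν).isLt)
    rwa [Finset.card_univ, Fintype.card_fin] at h
  have h2 : ∀ ν, ‖w ν ^ (a ν : ℕ) - w ν ^ (a' ν : ℕ)‖ ≤
      Real.exp κ * (‖dC n k p ν‖ / n) * |((a ν : ℕ) : ℝ) - ((a' ν : ℕ) : ℝ)| := by
    intro ν
    have h := norm_pow_sub_pow_le (hpow ν) (a ν).isLt (a' ν).isLt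
    rwa [hdC ν] at h
  calc ‖phase163 n k a p - phase163 n k a' p‖
      ≤ Real.exp κ ^ d * ∑ ν, ‖w ν ^ (a ν : ℕ) - w ν ^ (a' ν : ℕ)‖ := h1
    _ ≤ Real.exp κ ^ d * ∑ ν, Real.exp κ * (‖dC n k p ν‖ / n) * |((a ν : ℕ) : ℝ) - ((a' ν : ℕ) : ℝ)| :=
        mul_le_mul_of_nonneg_left (Finset.sum_le_sum fun ν _ => h2 ν) (by positivity)
    _ = Real.exp κ ^ (d + 1) / n * ∑ ν, ‖dC n k p ν‖ * |((a ν : ℕ) : ℝ) - ((a' ν : ℕ) : ℝ)| := by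
        rw [Finset.mul_sum, Finset.mul_sum]
        refine Finset.sum_congr rfl fun ν _ => ?_
        rw [pow_succ]
        field_simp

/-- THE TRIVIAL FORM: `‖e^{i(p′+l)·ηa} − e^{i(p′+l)·ηã}‖ ≤ 2(e^κ)^d` on the strip. [folklore] -/
private theorem norm_phase163_sub_le_two {κ : ℝ} {p : Fin d → ℂ} (hp : p ∈ Strip d κ) (k a a' : Fin d → Fin n) :
    ‖phase163 n k a p - phase163 n k a' p‖ ≤ 2 * Real.exp κ ^ d := by
  calc ‖phase163 n k a p - phase163 n k a' p‖ ≤ ‖phase163 n k a p‖ + ‖phase163 n k a' p‖ := norm_sub_le _ _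
    _ ≤ Real.exp κ ^ d + Real.exp κ ^ d := add_le_add (norm_phase163_le n hp k a) (norm_phase163_le n hp k a')
    _ = 2 * Real.exp κ ^ d := by ring

/-- **THE HÖLDER FORM** (the weight of `B6Hprime2132Holder.wtD`): on `Strip d κ` (`κ ≥ 0`), for fine offsets with
`|a_ν − ã_ν| ≤ δ` (`δ ≥ 0`) and `0 ≤ α ≤ 1`,
`‖e^{i(p′+l)·ηa} − e^{i(p′+l)·ηã}‖ ≤ 2e^{κ(d+1)}(d+1)·(δ/n)^α·(Σ_ν‖∂_ν(p′+l)‖²)^{α/2}`.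
[cite: Balaban1984PropagatorsII, p.246 (text only; inequality ours)] -/
theorem norm_phase163_sub_le_holder {κ : ℝ} (hκ0 : 0 ≤ κ) {p : Fin d → ℂ} (hp : p ∈ Strip d κ)
    (k a a' : Fin d → Fin n) {δ : ℝ} (hδ0 : 0 ≤ δ) (hδ : ∀ ν, |((a ν : ℕ) : ℝ) - ((a' ν : ℕ) : ℝ)| ≤ δ)
    {α : ℝ} (hα0 : 0 ≤ α) (hα1 : α ≤ 1) :
    ‖phase163 n k a p - phase163 n k a' p‖ ≤
      2 * Real.exp κ ^ (d + 1) * ((d : ℝ) + 1) * (δ / n) ^ α * (∑ ν, ‖dC n k p ν‖ ^ 2) ^ (α / 2) := by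
  have hn : (0 : ℝ) < n := Nat.cast_pos.mpr (Nat.pos_of_ne_zero (NeZero.ne n))
  have hB : 1 ≤ Real.exp κ := Real.one_le_exp hκ0
  have hE0 : 0 ≤ Real.exp κ ^ (d + 1) := pow_nonneg (Real.exp_pos κ).le _
  set S : ℝ := ∑ ν, ‖dC n k p ν‖ with hSdef
  have hS0 : 0 ≤ S := Finset.sum_nonneg fun ν _ => norm_nonneg _
  have hδn : 0 ≤ δ / n := div_nonneg hδ0 hn.le
  have ht0 : 0 ≤ δ / n * S := mul_nonneg hδn hS0
  -- the Lipschitz bound `X ≤ e^{κ(d+1)}·(δ/n)·S`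
  have hsum : ∑ ν, ‖dC n k p ν‖ * |((a ν : ℕ) : ℝ) - ((a' ν : ℕ) : ℝ)| ≤ δ * S := by
    rw [hSdef, Finset.mul_sum]
    refine Finset.sum_le_sum fun ν _ => ?_
    calc ‖dC n k p ν‖ * |((a ν : ℕ) : ℝ) - ((a' ν : ℕ) : ℝ)| ≤ ‖dC n k p ν‖ * δ :=
          mul_le_mul_of_nonneg_left (hδ ν) (norm_nonneg _)
      _ = δ * ‖dC n k p ν‖ := mul_comm _ _
  have hLip : ‖phase163 n k a p - phase163 n k a' p‖ ≤ (2 * Real.exp κ ^ (d + 1)) * (δ / n * S) := by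
    calc ‖phase163 n k a p - phase163 n k a' p‖
        ≤ Real.exp κ ^ (d + 1) / n * ∑ ν, ‖dC n k p ν‖ * |((a ν : ℕ) : ℝ) - ((a' ν : ℕ) : ℝ)| :=
          norm_phase163_sub_le_sum n hκ0 hp k a a'
      _ ≤ Real.exp κ ^ (d + 1) / n * (δ * S) := mul_le_mul_of_nonneg_left hsum (div_nonneg hE0 hn.le)
      _ = Real.exp κ ^ (d + 1) * (δ / n * S) := by field_simp
      _ ≤ (2 * Real.exp κ ^ (d + 1)) * (δ / n * S) := by nlinarith
  -- the trivial bound `X ≤ 2e^{κ(d+1)}`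
  have hTriv : ‖phase163 n k a p - phase163 n k a' p‖ ≤ 2 * Real.exp κ ^ (d + 1) := by
    refine (norm_phase163_sub_le_two n hp k a a').trans ?_
    rw [pow_succ]
    have h0 : 0 ≤ Real.exp κ ^ d := pow_nonneg (Real.exp_pos κ).le _
    nlinarith
  -- interpolate and split the power
  have hint := le_mul_rpow_of_le_of_le_mul (by positivity) ht0 hα0 hα1 hTriv hLip
  have hsplit : (δ / n * S) ^ α = (δ / n) ^ α * S ^ α := Real.mul_rpow hδn hS0
  have hcs : S ^ α ≤ ((d : ℝ) + 1) * (∑ ν, ‖dC n k p ν‖ ^ 2) ^ (α / 2) :=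
    rpow_sum_le_mul_rpow_sum_sq (fun ν => ‖dC n k p ν‖) (fun ν => norm_nonneg _) hα0 hα1
  calc ‖phase163 n k a p - phase163 n k a' p‖ ≤ 2 * Real.exp κ ^ (d + 1) * (δ / n * S) ^ α := hint
    _ = 2 * Real.exp κ ^ (d + 1) * (δ / n) ^ α * S ^ α := by rw [hsplit]; ring
    _ ≤ 2 * Real.exp κ ^ (d + 1) * (δ / n) ^ α * (((d : ℝ) + 1) * (∑ ν, ‖dC n k p ν‖ ^ 2) ^ (α / 2)) :=
        mul_le_mul_of_nonneg_left hcs (mul_nonneg (by positivity) (Real.rpow_nonneg hδn _))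
    _ = 2 * Real.exp κ ^ (d + 1) * ((d : ℝ) + 1) * (δ / n) ^ α * (∑ ν, ‖dC n k p ν‖ ^ 2) ^ (α / 2) := by ring

end Phase

/-! ## §3. The Hölder-difference multiplier `G′_{a;ν} − G′_{ã;ν}` on the zero-free strip -/

section Multiplier

variable (n : ℕ) [NeZero n]

/-- **THE HÖLDER-DIFFERENCE MULTIPLIER IS `O((η|a−ã|)^α)` ON THE WHOLE STRIP**: for `d ≥ 1`, every `n ≥ 1`,
`0 ≤ κ ≤ κ_N(d)`, `p′ ∈ Strip d κ`, `m ≤ 3` directions, `0 ≤ α < 1` and fine offsets with `|a_ν − ã_ν| ≤ δ`,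
`‖G′_{a;ν}(p′) − G′_{ã;ν}(p′)‖ = ‖Σ_l (e^{i(p′+l)·ηa} − e^{i(p′+l)·ηã})Π_i∂_{ν_i}(p′+l)h′_l(p′)‖
≤ 2e^{κ(d+1)}(d+1)·C′(d,m,α)·(δ/n)^α` — by `norm_phase163_sub_le_holder` and `B6Hprime2132Holder.weighted_alias_sum_hP_le`.
[cite: Balaban1984PropagatorsII, (2.132) p.246 (text of the claim only; proof and constant ours)] -/
theorem norm_GHD_sub_le (hd : 0 < d) {κ : ℝ} (hκ0 : 0 ≤ κ) (hκ : κ ≤ kappaN d) {p : Fin d → ℂ}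
    (hp : p ∈ Strip d κ) (a a' : Fin d → Fin n) {δ : ℝ} (hδ0 : 0 ≤ δ)
    (hδ : ∀ ν, |((a ν : ℕ) : ℝ) - ((a' ν : ℕ) : ℝ)| ≤ δ) {m : ℕ} (νs : Fin m → Fin d) (hm : m ≤ 3)
    {α : ℝ} (hα0 : 0 ≤ α) (hα1 : α < 1) :
    ‖GHD n a νs p - GHD n a' νs p‖ ≤
      2 * Real.exp κ ^ (d + 1) * ((d : ℝ) + 1) * CHolder2132 d m α * (δ / n) ^ α := by
  have hn : (0 : ℝ) < n := Nat.cast_pos.mpr (Nat.pos_of_ne_zero (NeZero.ne n))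
  have hδn : 0 ≤ (δ / n) ^ α := Real.rpow_nonneg (div_nonneg hδ0 hn.le) _
  have hsum := weighted_alias_sum_hP_le n hd hκ0 hκ hp νs hm hα0 hα1
  set C : ℝ := 2 * Real.exp κ ^ (d + 1) * ((d : ℝ) + 1) * (δ / n) ^ α with hCdef
  have hC0 : 0 ≤ C := by rw [hCdef]; positivity
  have hdiff : GHD n a νs p - GHD n a' νs p =
      ∑ k : Fin d → Fin n, (phase163 n k a p - phase163 n k a' p) * (∏ i, dC n k p (νs i)) * hP n k p := by
    unfold GHD
    rw [← Finset.sum_sub_distrib]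
    refine Finset.sum_congr rfl fun k _ => ?_
    ring
  rw [hdiff]
  calc ‖∑ k : Fin d → Fin n, (phase163 n k a p - phase163 n k a' p) * (∏ i, dC n k p (νs i)) * hP n k p‖
      ≤ ∑ k : Fin d → Fin n, ‖(phase163 n k a p - phase163 n k a' p) * (∏ i, dC n k p (νs i)) * hP n k p‖ :=
        norm_sum_le _ _
    _ ≤ ∑ k : Fin d → Fin n, C * (‖hP n k p‖ * wtD n k p νs α) := by
        refine Finset.sum_le_sum fun k _ => ?_
        rw [norm_mul, norm_mul, norm_prod]
        have hph := norm_phase163_sub_le_holder n hκ0 hp k a a' hδ0 hδ hα0 hα1.le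
        have h0 : 0 ≤ (∏ i, ‖dC n k p (νs i)‖) * ‖hP n k p‖ :=
          mul_nonneg (Finset.prod_nonneg fun _ _ => norm_nonneg _) (norm_nonneg _)
        unfold wtD
        calc ‖phase163 n k a p - phase163 n k a' p‖ * (∏ i, ‖dC n k p (νs i)‖) * ‖hP n k p‖
            = ‖phase163 n k a p - phase163 n k a' p‖ * ((∏ i, ‖dC n k p (νs i)‖) * ‖hP n k p‖) := by ring
          _ ≤ (2 * Real.exp κ ^ (d + 1) * ((d : ℝ) + 1) * (δ / n) ^ α * (∑ ν, ‖dC n k p ν‖ ^ 2) ^ (α / 2)) *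
                ((∏ i, ‖dC n k p (νs i)‖) * ‖hP n k p‖) := mul_le_mul_of_nonneg_right hph h0
          _ = C * (‖hP n k p‖ * ((∏ i, ‖dC n k p (νs i)‖) * (∑ ν, ‖dC n k p ν‖ ^ 2) ^ (α / 2))) := by
                rw [hCdef]; ring
    _ = C * ∑ k : Fin d → Fin n, ‖hP n k p‖ * wtD n k p νs α := by rw [← Finset.mul_sum]
    _ ≤ C * CHolder2132 d m α := mul_le_mul_of_nonneg_left hsum hC0
    _ = 2 * Real.exp κ ^ (d + 1) * ((d : ℝ) + 1) * CHolder2132 d m α * (δ / n) ^ α := by rw [hCdef]; ring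

end Multiplier

/-! ## §4. Strip regularity of the Hölder-difference multiplier on `ℂ^{d+1}` -/

section Regular

/-- **STRIP REGULARITY OF THE HÖLDER-DIFFERENCE MULTIPLIER** on `ℂ^{d+1}`: for every `n ≥ 1`, fine offsets `a, ã` with
`|a_ν − ã_ν| ≤ δ`, `m ≤ 3` directions, `0 ≤ α < 1` and `0 ≤ κ ≤ κ_N(d+1)`, `p′ ↦ G′_{a;ν}(p′) − G′_{ã;ν}(p′)` is continuous on
the closed strip, holomorphic in each coordinate slice, takes equal values on the vertical sides, and is bounded by
`2e^{d+2}(d+2)·C′(d+1,m,α)·(δ/n)^α` — the bound carries the Hölder smallness. [cite: Balaban1984PropagatorsII, p.246 (text only; construction ours)] -/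
theorem stripRegular_GHD_sub (n : ℕ) [NeZero n] {κ : ℝ} (hκ0 : 0 ≤ κ) (hκ : κ ≤ kappaN (d + 1))
    (a a' : Fin (d + 1) → Fin n) {δ : ℝ} (hδ0 : 0 ≤ δ)
    (hδ : ∀ ν, |((a ν : ℕ) : ℝ) - ((a' ν : ℕ) : ℝ)| ≤ δ) {m : ℕ} (νs : Fin m → Fin (d + 1)) (hm : m ≤ 3)
    {α : ℝ} (hα0 : 0 ≤ α) (hα1 : α < 1) :
    StripRegular (d := d) (fun p : Fin (d + 1) → ℂ => GHD n a νs p - GHD n a' νs p) κ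
      (2 * Real.exp 1 ^ (d + 2) * ((d : ℝ) + 2) * CHolder2132 (d + 1) m α * (δ / n) ^ α) := by
  have hn : (0 : ℝ) < n := Nat.cast_pos.mpr (Nat.pos_of_ne_zero (NeZero.ne n))
  have hκ1 : κ ≤ 1 := (kappa_small hκ0 (hκ.trans (kappaN_le_rOf _))).1
  have hdiffAt : ∀ p ∈ Strip (d + 1) κ,
      DifferentiableAt ℂ (fun q : Fin (d + 1) → ℂ => GHD n a νs q - GHD n a' νs q) p :=
    fun p hp => (differentiableAt_GHD n hκ0 hκ hp a νs).sub (differentiableAt_GHD n hκ0 hκ hp a' νs)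
  refine ⟨?_, ?_, ?_, ?_⟩
  · exact fun p hp => (hdiffAt p hp).continuousAt.continuousWithinAt
  · intro i q hq z hz
    have hP : i.insertNth z (ofRealVec q) ∈ Strip (d + 1) κ :=
      insertNth_mem_Strip hκ0 i hq (openRect_subset_closedRect κ hz)
    exact ((hdiffAt _ hP).comp z (differentiableAt_insertNth i _ z)).differentiableWithinAt
  · intro i q hq y hy
    obtain ⟨hP, hre⟩ := insertNth_left_mem hκ0 i hq hy
    show GHD n a νs _ - GHD n a' νs _ = GHD n a νs _ - GHD n a' νs _
    rw [← tr_insertNth_left, GHD_tr n hκ0 hκ hP i hre a νs, GHD_tr n hκ0 hκ hP i hre a' νs]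
  · intro p hp
    refine (norm_GHD_sub_le n (Nat.succ_pos d) hκ0 hκ hp a a' hδ0 hδ νs hm hα0 hα1).trans ?_
    have hC := CHolder2132_nonneg (d + 1) m α
    have hδn : 0 ≤ (δ / n) ^ α := Real.rpow_nonneg (div_nonneg hδ0 hn.le) _
    have he : Real.exp κ ^ (d + 1 + 1) ≤ Real.exp 1 ^ (d + 2) :=
      pow_le_pow_left₀ (Real.exp_pos κ).le (Real.exp_le_exp.mpr hκ1) _
    have hcast : (((d + 1 : ℕ) : ℝ) + 1) = (d : ℝ) + 2 := by push_cast; ring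
    rw [hcast]
    have h0 : 0 ≤ ((d : ℝ) + 2) * CHolder2132 (d + 1) m α * (δ / n) ^ α := by positivity
    calc 2 * Real.exp κ ^ (d + 1 + 1) * ((d : ℝ) + 2) * CHolder2132 (d + 1) m α * (δ / n) ^ α
        = Real.exp κ ^ (d + 1 + 1) * (2 * (((d : ℝ) + 2) * CHolder2132 (d + 1) m α * (δ / n) ^ α)) := by ring
      _ ≤ Real.exp 1 ^ (d + 2) * (2 * (((d : ℝ) + 2) * CHolder2132 (d + 1) m α * (δ / n) ^ α)) :=
          mul_le_mul_of_nonneg_right he (by positivity)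
      _ = 2 * Real.exp 1 ^ (d + 2) * ((d : ℝ) + 2) * CHolder2132 (d + 1) m α * (δ / n) ^ α := by ring

end Regular

/-! ## §5. The local Hölder quotients of the derivative kernels of `H′_j`: lattice `ℤ^{d+1}` and tori -/

section Kernel

/-- linearity of the lattice kernel over strip-regular (hence integrable) multipliers:
`K[G₁ − G₂] = K[G₁] − K[G₂]`. [folklore] -/
private theorem latticeKernel_sub {G₁ G₂ : (Fin (d + 1) → ℂ) → ℂ} {κ M₁ M₂ : ℝ} (h₁ : StripRegular G₁ κ M₁)
    (h₂ : StripRegular G₂ κ M₂) (hκ : 0 ≤ κ) (x : Fin (d + 1) → ℤ) :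
    latticeKernel (fun p => G₁ p - G₂ p) x = latticeKernel G₁ x - latticeKernel G₂ x := by
  unfold latticeKernel fourierBox
  have hint : ∀ p : Fin (d + 1) → ℝ,
      integrand (fun q => G₁ q - G₂ q) x p = integrand G₁ x p - integrand G₂ x p := fun p => by
    unfold integrand
    ring
  simp_rw [hint]
  rw [MeasureTheory.integral_sub (h₁.integrableOn hκ x) (h₂.integrableOn hκ x), smul_sub]

/-- **THE LOCAL HÖLDER QUOTIENTS OF THE DERIVATIVE KERNELS OF `H′_j` ARE UNIFORMLY BOUNDED WITH A UNIFORM EXPONENTIAL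
DECAY** (infinite lattice `ℤ^{d+1}`; `B4ContourShift.latticeKernel_decay` by name): for every `n ≥ 1`, `m ≤ 3` directions,
`0 ≤ α < 1`, fine offsets `a, ã ∈ {0,…,n−1}^{d+1}` with `|a_ν − ã_ν| ≤ δ` (two fine points of the SAME unit cube) and
every `x ∈ ℤ^{d+1}`,
`‖K′_{a;ν}(x) − K′_{ã;ν}(x)‖ ≤ 2e^{d+2}(d+2)·C′(d+1,m,α)·(δ/n)^α·e^{−κ_N(d+1)|x|_∞}`; with `δ = |a − ã|_∞` this is the
Hölder quotient `|∂^ξ_{ν₁}⋯∂^ξ_{ν_m}H′_j(y+ηa,y′) − ∂^ξ_{ν₁}⋯∂^ξ_{ν_m}H′_j(y+ηã,y′)|/|ηa − ηã|_∞^α ≤ C(d,m,α)e^{−κ_N(d+1)|y−y′|_∞}`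
— *"derivatives of H′_j up to third order, and their local Hölder norms as in (2.67), are uniformly bounded and have a
uniform exponential decay with a decay rate depending on d only"*. [cite: Balaban1984PropagatorsII, (2.132) p.246] -/
theorem latticeKernel_GHD_holder (n : ℕ) [NeZero n] (a a' : Fin (d + 1) → Fin n) {δ : ℝ} (hδ0 : 0 ≤ δ)
    (hδ : ∀ ν, |((a ν : ℕ) : ℝ) - ((a' ν : ℕ) : ℝ)| ≤ δ) {m : ℕ} (νs : Fin m → Fin (d + 1)) (hm : m ≤ 3)
    {α : ℝ} (hα0 : 0 ≤ α) (hα1 : α < 1) (x : Fin (d + 1) → ℤ) :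
    ‖latticeKernel (fun p : Fin (d + 1) → ℂ => GHD n a νs p) x -
        latticeKernel (fun p : Fin (d + 1) → ℂ => GHD n a' νs p) x‖ ≤
      2 * Real.exp 1 ^ (d + 2) * ((d : ℝ) + 2) * CHolder2132 (d + 1) m α * (δ / n) ^ α *
        Real.exp (-(kappaN (d + 1) * supNorm x)) := by
  have hκ := (kappaN_pos (d + 1)).le
  rw [← latticeKernel_sub (stripRegular_GHD n hκ le_rfl a νs hm) (stripRegular_GHD n hκ le_rfl a' νs hm) hκ x]
  exact latticeKernel_decay (stripRegular_GHD_sub n hκ le_rfl a a' hδ0 hδ νs hm hα0 hα1) hκ x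

/-- linearity of the torus kernel of the descent (a finite Fourier sum). [folklore] -/
private theorem torusKernel_descend_sub {G₁ G₂ : (Fin (d + 1) → ℂ) → ℂ} {κ M₁ M₂ M : ℝ} (h₁ : StripRegular G₁ κ M₁)
    (h₂ : StripRegular G₂ κ M₂) (h : StripRegular (fun p => G₁ p - G₂ p) κ M) (hκ : 0 ≤ κ)
    (N : Fin (d + 1) → ℕ) (x : Fin (d + 1) → ℤ) :
    torusKernel (descendC (fun p => G₁ p - G₂ p) h hκ) N x =
      torusKernel (descendC G₁ h₁ hκ) N x - torusKernel (descendC G₂ h₂ hκ) N x := by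
  unfold torusKernel torusSum
  rw [← mul_sub, ← Finset.sum_sub_distrib]
  congr 1
  refine Finset.sum_congr rfl fun k _ => ?_
  simp only [descendC_apply, descend]
  ring

/-- **THE SAME ON EVERY TORUS `Π_μ ℤ/N_μ`** (`B4TorusKernel.MultiPeriod.torusKernel_descend_decay_torusMetric` by name): for
every period vector (all `N_μ ≥ 1`), `n ≥ 1`, `m ≤ 3` directions, `0 ≤ α < 1`, fine offsets with `|a_ν − ã_ν| ≤ δ` and every
`x`, the difference of the torus kernels of the `m`-th derivative multipliers at the two fine offsets is bounded by
`2e^{d+2}(d+2)·C′(d+1,m,α)·(δ/n)^α · periodConst(κ_N(d+1), d) · e^{−(κ_N(d+1)/(d+1))·|x|_{T,∞}}`.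
[cite: Balaban1984PropagatorsII, (2.132) p.246] -/
theorem torusKernel_GHD_holder (n : ℕ) [NeZero n] (a a' : Fin (d + 1) → Fin n) {δ : ℝ} (hδ0 : 0 ≤ δ)
    (hδ : ∀ ν, |((a ν : ℕ) : ℝ) - ((a' ν : ℕ) : ℝ)| ≤ δ) {m : ℕ} (νs : Fin m → Fin (d + 1)) (hm : m ≤ 3)
    {α : ℝ} (hα0 : 0 ≤ α) (hα1 : α < 1) {N : Fin (d + 1) → ℕ} (hN : ∀ i, 1 ≤ N i) (x : Fin (d + 1) → ℤ) :
    ‖torusKernel (descendC (fun p : Fin (d + 1) → ℂ => GHD n a νs p)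
          (stripRegular_GHD n (kappaN_pos _).le le_rfl a νs hm) (kappaN_pos _).le) N x -
        torusKernel (descendC (fun p : Fin (d + 1) → ℂ => GHD n a' νs p)
          (stripRegular_GHD n (kappaN_pos _).le le_rfl a' νs hm) (kappaN_pos _).le) N x‖ ≤
      2 * Real.exp 1 ^ (d + 2) * ((d : ℝ) + 2) * CHolder2132 (d + 1) m α * (δ / n) ^ α *
        periodConst (kappaN (d + 1)) d * Real.exp (-(kappaN (d + 1) / (d + 1) * torusSupNorm N x)) := by
  have hκ := kappaN_pos (d + 1)
  have hreg := stripRegular_GHD_sub n hκ.le le_rfl a a' hδ0 hδ νs hm hα0 hα1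
  rw [← torusKernel_descend_sub (stripRegular_GHD n hκ.le le_rfl a νs hm) (stripRegular_GHD n hκ.le le_rfl a' νs hm)
    hreg hκ.le N x]
  exact torusKernel_descend_decay_torusMetric hreg hκ hN x

end Kernel

end Literature.MathematicalPhysics.QuantumFieldTheory.Balaban1983to89.B6Hprime2132HolderKernel
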